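/- Copyright: the b2b-balaban cell (near-miss cell 7), T⁴-continuum fan-out, lineage t4-ne7b-p1 (row NE7b OWNER, gen 47).
Released under the licence of the surrounding project. -/
import Summits.QuantumFields.BalabanUV.T4Continuum.Support.B16HistoryIndexedFamily
import Literature.MathematicalPhysics.QuantumFieldTheory.Balaban1983to89.T4LiveClassFibration

/-!
# The truncation aggregate: run B's (1.72) terms read on run A's term set — re-open object (α) of row NE7b,
`SCOPE-alpha.md` §5 row M2, brick C (ruling R-OWNER-46-2 «(2R) = ONE INDEX, RUN B AGGREGATED BY TRUNCATION»; INTERFACE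
REQUEST IR-46-2 «THE (α) ASSEMBLY», run-B side v0 → v0.5) — PRE-POSITIONING ONLY; owner lineage `t4-ne7b-p1` gen 47

Summits-side support leaf of the T⁴-continuum cell (rung (B)+1 on a FINITE torus only; NOT infinite volume, NOT the
mass gap, NOT Clay; NOT a proof of NE7b — the cell's OWN estimate, NOT PRINTED, NOT PROVED).  [folklore] finite-sum
bookkeeping (Mathlib `Finset.sum_fiberwise_of_maps_to`) over M2-A (`B16HistoryIndexedFamily`: `HIndex.Idx`, `termSet`,
`Repr172R.weight`, `repr_of_holds`) and the Literature fibre `T4LiveClassFibration.fibre`; nothing printed asserted, no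
`def … : Prop` fact of Bałaban's, no cite-tagged hypothesis, zero `sorry`.

WHY.  The END of row NE7b (`HistoryRealiseCellsRunApexT3bWTVS.CountRoadWitnessT3bWTVS`) indexes BOTH IR-matched runs by
ONE source-free term set `T K` per cutoff (run A: `K` steps; run B: `K + 1` steps, fields `A' reprB dead' mup FcM' RfM'
priceM' upM' deadM'_nonneg resumM' FM'_nonneg`).  M2-A gives each run ITS OWN history-indexed family (`termSet I K` for
run A's skeleton `I`, `termSet I' (K + 1)` for run B's skeleton `I'` at ITS final level).  Ruling R-OWNER-46-2 (journal
l.31704, adopting the custodian leaf-03-g26's reading R-ne7bleaf03g26-2R): the assembly indexes both runs by run A's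
skeleton and AGGREGATES run B's level-`(K+1)` terms onto it by a TRUNCATION map `trunc K : Idx I' → Idx I` of the
level-`(K+1)` history at level `K` (NODE O's synchronisation as DATA), `A' K t τ := Σ_{τ' ↦ τ} weight′ τ'`; «not a
disjoint union» (incompatible with NE7's term-wise `ReindexedBudget` sandwich).

WHAT (all [folklore]).  §1 the generic aggregate **`aggW trunc S w K t τ := Σ_{τ' ∈ S K, trunc K τ' = τ} w K t τ'`** with
THE AGGREGATION IDENTITY **`sum_aggW_eq`** (`MapsTo (trunc K) (S K) (T K)` ⟹ `Σ_{τ ∈ T K} aggW = Σ_{τ' ∈ S K} w`), the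
partial-sum identity **`sum_aggW_eq_sum_filter`** (any `P : Finset ι`: `Σ_{τ ∈ P} aggW = Σ_{τ' ∈ S K, trunc K τ' ∈ P} w` —
the COMPOSITE FIBRE), linearity (`aggW_add`∕`aggW_sub`∕`aggW_const_mul`), order (`aggW_mono`, `aggW_nonneg`,
`abs_aggW_le`, **`aggW_le_aggW_mul`**: term-wise `w ≤ d·c` with a COMMON factor `c` ⟹ `aggW w ≤ aggW d · c`, no sign
condition), support (`aggW_eq_zero_of_forall_ne`); §2 THE END's RUN-B NUMERATOR SHAPES PER AGGREGATE, keyed at run A's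
keys `kmem K : ι → κ` over the Literature fibre `fibre kmem T K k`: **`upM'_of_trunc`** (per run-B term `τ'` truncating
INTO the fibre of `k`, `w' τ' ≤ dead' τ' · FcM' K k · mup K t` ⟹ the END's `upM'` clause for the aggregates
`aggW w'`, `aggW dead'`), **`deadM'_nonneg_of_trunc`**, **`resumM'_of_trunc`** (a run-B fibre-mass display over the
COMPOSITE fibre `{τ' ∈ S K ∣ trunc K τ' ∈ fibre kmem T K k}` ⟹ the END's `resumM'` for `aggW dead'`), and the
composite fibre's membership lemma `mem_truncFibre`; §3 AT M2-A's LETTERS: **`weightB ν RB trunc`** (run B's weights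
`weight ν RB t` over `termSet I' (K + 1)` aggregated through `trunc K`) and **`reprB_of_holds_trunc`**: run B's displayed
H2 identity `ZB t = ∫ ρB t dν_{K+1}` + per-level «(1.72) holds» + integrability (M2-A's `repr_of_holds` AT CUTOFF
`K + 1`) + `MapsTo (trunc K) (termSet I' (K+1)) (termSet I K)` ⟹ `ZB t = Σ_{τ ∈ termSet I K} weightB ν RB trunc K t τ`
— LETTER FOR LETTER the shape of `CountRoadWitnessT3bWTVS.reprB` with `T := termSet I`, `A' := weightB ν RB trunc`;
**`repr_pair_of_holds_trunc`** (run A by `repr_of_holds` at `K`, run B by the above — the END's PAIR over ONE `T K`);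
`abs_weightB_le` (U1 integrated per aggregate: `|weightB| ≤ Σ_fibre |weight|`); §4 a decided two-level toy (`Fin 3 → Fin 2`).

BY-NAME EFFECT ON THE WALL (`WALL-NE7b-P1.md` §2, run-B rows): `reprB` becomes KERNEL modulo {run B's own (1.72)-holds ∕
integrability ∕ H2 displays (as run A), the truncation DATA `trunc` with its `MapsTo` clause (S-class, NODE O)}; `upM'`,
`deadM'_nonneg`, `resumM'` become KERNEL modulo run B's PER-TERM numerator readings KEYED AT RUN A's KEYS (R «TRUNC»: the
live price of a run-B term is read at the key of its truncation — NODE O's matching of run B's level-`(j+1)` letters to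
run A's level-`j` letters) and ONE composite-fibre mass display (ρ′) (R, volume type, as (ρ)).  `FcM'`∕`RfM'`∕`priceM'`∕
`FM'_nonneg` are run A's key-level letters instantiated at run B's constants (leaf-02's B′ `HistoryPriceKeys`, the same
lemma on the same `memOf` — INBOX l.9297).  Nothing else moves; NE7b NOT PROVED by this.

HONEST DEPENDENCY (cell): continuum YM on T⁴ ⇐ BetaPertH ∧ nine spine estimates (0/9 proved); BetaPertH ⇐ (D1) ∧ (D4)
∧ CAP+tail; G-an2-4 gates asym, D1 and NE2/3/4.  This file changes none of it.
-/

open Finset MeasureTheory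
open Literature.MathematicalPhysics.QuantumFieldTheory.Balaban1983to89
open Literature.MathematicalPhysics.QuantumFieldTheory.Balaban1983to89.T4LiveClassFibration (fibre mem_fibre)

namespace Summit.QuantumFields.BalabanUV.T4Continuum.B16HistoryIndexedTrunc

noncomputable section

/-! ## §1 The truncation aggregate (generic finite-sum bookkeeping) -/

section Agg

variable {ι ι' : Type*} [DecidableEq ι] (trunc : ℕ → ι' → ι) (S : ℕ → Finset ι') (w d : ℕ → ℝ → ι' → ℝ)
  {K : ℕ} {t : ℝ} {τ : ι}

/-- **THE TRUNCATION AGGREGATE**: run B's per-term datum `w K t τ'` summed over the run-B terms `τ' ∈ S K` whose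
truncation is the run-A index `τ` ([our object]; R-OWNER-46-2's `A' K t τ := Σ_{τ' ↦ τ} weight′ τ'`). [folklore] -/
def aggW (K : ℕ) (t : ℝ) (τ : ι) : ℝ := ∑ τ' ∈ (S K).filter (fun τ' => trunc K τ' = τ), w K t τ'

/-- unfolding the aggregate [folklore] -/
theorem aggW_def (K : ℕ) (t : ℝ) (τ : ι) :
    aggW trunc S w K t τ = ∑ τ' ∈ (S K).filter (fun τ' => trunc K τ' = τ), w K t τ' := rfl

variable {trunc S w d}

/-- **THE AGGREGATION IDENTITY**: if every run-B term truncates INTO run A's term set `T K`, the aggregates over `T K`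
re-sum run B's terms exactly (`Finset.sum_fiberwise_of_maps_to`). [folklore] -/
theorem sum_aggW_eq {T : ℕ → Finset ι} (h : ∀ τ' ∈ S K, trunc K τ' ∈ T K) :
    ∑ τ ∈ T K, aggW trunc S w K t τ = ∑ τ' ∈ S K, w K t τ' :=
  Finset.sum_fiberwise_of_maps_to h _

/-- **THE COMPOSITE FIBRE**: the aggregates summed over ANY finite set `P` of run-A indices re-sum run B's terms
truncating into `P` (no `MapsTo` clause needed). [folklore] -/
theorem sum_aggW_eq_sum_filter (P : Finset ι) :
    ∑ τ ∈ P, aggW trunc S w K t τ = ∑ τ' ∈ (S K).filter (fun τ' => trunc K τ' ∈ P), w K t τ' := by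
  have h : ∀ τ' ∈ (S K).filter (fun τ' => trunc K τ' ∈ P), trunc K τ' ∈ P := fun τ' h => (mem_filter.1 h).2
  rw [← Finset.sum_fiberwise_of_maps_to h]
  refine Finset.sum_congr rfl fun τ hτ => Finset.sum_congr ?_ fun _ _ => rfl
  rw [Finset.filter_filter]
  exact Finset.filter_congr fun τ' _ => ⟨fun h => ⟨h ▸ hτ, h⟩, fun h => h.2⟩

/-- the aggregate of a sum is the sum of the aggregates (e.g. core + shell parts, NE7c) [folklore] -/
theorem aggW_add (K : ℕ) (t : ℝ) (τ : ι) :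
    aggW trunc S (fun K t τ' => w K t τ' + d K t τ') K t τ = aggW trunc S w K t τ + aggW trunc S d K t τ := by
  simp only [aggW, Finset.sum_add_distrib]

/-- the aggregate of a difference is the difference of the aggregates [folklore] -/
theorem aggW_sub (K : ℕ) (t : ℝ) (τ : ι) :
    aggW trunc S (fun K t τ' => w K t τ' - d K t τ') K t τ = aggW trunc S w K t τ - aggW trunc S d K t τ := by
  simp only [aggW, Finset.sum_sub_distrib]

/-- a term-free factor comes out of the aggregate [folklore] -/
theorem aggW_const_mul (c : ℕ → ℝ → ℝ) (K : ℕ) (t : ℝ) (τ : ι) :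
    aggW trunc S (fun K t τ' => c K t * w K t τ') K t τ = c K t * aggW trunc S w K t τ := by
  simp only [aggW, Finset.mul_sum]

/-- the aggregate is monotone in the per-term data on its fibre [folklore] -/
theorem aggW_mono (h : ∀ τ' ∈ S K, trunc K τ' = τ → w K t τ' ≤ d K t τ') :
    aggW trunc S w K t τ ≤ aggW trunc S d K t τ :=
  Finset.sum_le_sum fun τ' h' => h τ' (mem_filter.1 h').1 (mem_filter.1 h').2

/-- non-negative per-term data aggregate to a non-negative datum [folklore] -/
theorem aggW_nonneg (h : ∀ τ' ∈ S K, trunc K τ' = τ → 0 ≤ w K t τ') : 0 ≤ aggW trunc S w K t τ :=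
  Finset.sum_nonneg fun τ' h' => h τ' (mem_filter.1 h').1 (mem_filter.1 h').2

/-- the aggregate is bounded by the aggregate of the absolute values [folklore] -/
theorem abs_aggW_le (K : ℕ) (t : ℝ) (τ : ι) :
    |aggW trunc S w K t τ| ≤ aggW trunc S (fun K t τ' => |w K t τ'|) K t τ :=
  Finset.abs_sum_le_sum_abs _ _

/-- **A COMMON FACTOR SURVIVES AGGREGATION**: term-wise `w τ' ≤ d τ' · c` on the fibre of `τ`, with ONE factor `c` for
the whole fibre, gives `aggW w τ ≤ aggW d τ · c` — NO sign condition on `c` or on the data (a sum of inequalities).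
This is why run B's live price must be READ AT RUN A's KEY («TRUNC»). [folklore] -/
theorem aggW_le_aggW_mul (c : ℝ) (h : ∀ τ' ∈ S K, trunc K τ' = τ → w K t τ' ≤ d K t τ' * c) :
    aggW trunc S w K t τ ≤ aggW trunc S d K t τ * c := by
  rw [aggW_def trunc S d, Finset.sum_mul]
  exact Finset.sum_le_sum fun τ' h' => h τ' (mem_filter.1 h').1 (mem_filter.1 h').2

/-- off the image of the truncation the aggregate vanishes [folklore] -/
theorem aggW_eq_zero_of_forall_ne (h : ∀ τ' ∈ S K, trunc K τ' ≠ τ) : aggW trunc S w K t τ = 0 := by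
  rw [aggW_def]
  refine Finset.sum_eq_zero fun τ' h' => ?_
  exact absurd (mem_filter.1 h').2 (h τ' (mem_filter.1 h').1)

/-- membership in the fibre of the truncation over `τ` [folklore] -/
theorem mem_aggFibre {τ' : ι'} : τ' ∈ (S K).filter (fun τ' => trunc K τ' = τ) ↔ τ' ∈ S K ∧ trunc K τ' = τ :=
  mem_filter

end Agg

/-! ## §2 The END's run-B numerator shapes per aggregate, keyed at run A's keys -/

section Numerator

variable {ι ι' κ : Type*} [DecidableEq ι] [DecidableEq κ] {trunc : ℕ → ι' → ι} {S : ℕ → Finset ι'}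
  {w d : ℕ → ℝ → ι' → ℝ} {kmem : ℕ → ι → κ} {T : ℕ → Finset ι} {K : ℕ} {t : ℝ} {k : κ}

/-- **THE COMPOSITE FIBRE OF A KEY**: a run-B term lies over the run-A fibre of the key `k` iff its truncation is a
run-A term with key `k`. [folklore] -/
theorem mem_truncFibre {τ' : ι'} :
    τ' ∈ (S K).filter (fun τ' => trunc K τ' ∈ fibre kmem T K k) ↔
      τ' ∈ S K ∧ trunc K τ' ∈ T K ∧ kmem K (trunc K τ') = k := by
  rw [mem_filter, mem_fibre]

/-- **THE END's `upM'` PER AGGREGATE**: if every run-B term truncating into the run-A fibre of the key `k` is below its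
dead weight times THE key's live price `FcM' K k` times the envelope `mup K t` (run B's numerator reading, READ AT RUN
A's KEY), then so is every aggregate over that fibre, with the aggregated dead weight. [folklore] -/
theorem upM'_of_trunc (FcM' : ℕ → κ → ℝ) (mup : ℕ → ℝ → ℝ)
    (h : ∀ τ' ∈ S K, trunc K τ' ∈ fibre kmem T K k → w K t τ' ≤ d K t τ' * FcM' K k * mup K t) :
    ∀ τ ∈ fibre kmem T K k, aggW trunc S w K t τ ≤ aggW trunc S d K t τ * FcM' K k * mup K t := by
  intro τ hτ
  rw [mul_assoc]
  exact aggW_le_aggW_mul _ fun τ' h' he => by rw [← mul_assoc]; exact h τ' h' (he ▸ hτ)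

/-- **THE END's `deadM'_nonneg` PER AGGREGATE**: non-negative run-B dead weights over the composite fibre aggregate to
non-negative dead weights on the run-A fibre. [folklore] -/
theorem deadM'_nonneg_of_trunc (h : ∀ τ' ∈ S K, trunc K τ' ∈ fibre kmem T K k → 0 ≤ d K t τ') :
    ∀ τ ∈ fibre kmem T K k, 0 ≤ aggW trunc S d K t τ :=
  fun _ hτ => aggW_nonneg fun τ' h' he => h τ' h' (he ▸ hτ)

/-- **THE END's `resumM'` PER AGGREGATE**: a run-B FIBRE-MASS display over the COMPOSITE fibre of the key `k` (the
located volume-type display (ρ′), as (ρ) for run A) is exactly the END's `resumM'` clause for the aggregated dead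
weights (`sum_aggW_eq_sum_filter`). [folklore] -/
theorem resumM'_of_trunc (RfM' : ℕ → κ → ℝ)
    (h : ∑ τ' ∈ (S K).filter (fun τ' => trunc K τ' ∈ fibre kmem T K k), d K t τ' ≤ RfM' K k) :
    ∑ τ ∈ fibre kmem T K k, aggW trunc S d K t τ ≤ RfM' K k := by
  rwa [sum_aggW_eq_sum_filter]

/-- the aggregated dead mass of a key IS run B's dead mass over the composite fibre (the identity behind
`resumM'_of_trunc`, displayed for the records) [folklore] -/
theorem sum_fibre_aggW_eq :
    ∑ τ ∈ fibre kmem T K k, aggW trunc S d K t τ =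
      ∑ τ' ∈ (S K).filter (fun τ' => trunc K τ' ∈ fibre kmem T K k), d K t τ' :=
  sum_aggW_eq_sum_filter _

end Numerator

/-! ## §3 At M2-A's letters: run B's representation over run A's term set -/

section ReprB

open B16HistoryIndexedRepr B16HistoryIndexedRepr.HIndex B16HistoryIndexedRepr.Repr172R

variable {DomK DomK' : ℕ → Type*} {I : (K : ℕ) → HIndex (DomK K)} {I' : (K : ℕ) → HIndex (DomK' K)}
  [DecidableEq (Idx I)]
  {X Y : ℕ → Type*} [∀ K, MeasurableSpace (X K)] [∀ K, MeasurableSpace (Y K)]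
  {𝒢 : (K : ℕ) → GoodClass (X K)} {𝒢' : (K : ℕ) → GoodClass (Y K)}

/-- **RUN B's WEIGHTS AGGREGATED ON RUN A's INDEX**: the weights `weight ν RB t τ'` of run B's level-`(K+1)` terms
`τ' ∈ termSet I' (K + 1)` summed over the truncation fibre of `τ : Idx I` ([our object]; the `A'` of the END under
R-OWNER-46-2). [folklore] -/
def weightB (ν : (K : ℕ) → Measure (Y K)) (RB : (K : ℕ) → ℝ → Repr172R (𝒢' K) (I' K))
    (trunc : ℕ → Idx I' → Idx I) : ℕ → ℝ → Idx I → ℝ :=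
  aggW trunc (fun K => termSet I' (K + 1)) (fun _ t τ' => weight ν RB t τ')

/-- unfolding `weightB` [folklore] -/
theorem weightB_def (ν : (K : ℕ) → Measure (Y K)) (RB : (K : ℕ) → ℝ → Repr172R (𝒢' K) (I' K))
    (trunc : ℕ → Idx I' → Idx I) (K : ℕ) (t : ℝ) (τ : Idx I) :
    weightB ν RB trunc K t τ = ∑ τ' ∈ (termSet I' (K + 1)).filter (fun τ' => trunc K τ' = τ), weight ν RB t τ' := rfl

/-- **THE END's `reprB` FROM RUN B's OWN (1.72)-HOLDS, H2 IDENTITY AND A TRUNCATION INTO RUN A's TERM SET**: run B's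
displayed identity `ZB t = ∫ ρB t dν_{K+1}`, per-level «(1.72) holds» and integrability AT ITS CUTOFF `K + 1` (M2-A's
`repr_of_holds`), plus `MapsTo (trunc K) (termSet I' (K+1)) (termSet I K)`, give `ZB t = Σ_{τ ∈ termSet I K} weightB … K t τ`
— the shape of `CountRoadWitnessT3bWTVS.reprB` with `T := termSet I`, `A' := weightB ν RB trunc`. [folklore] -/
theorem reprB_of_holds_trunc (ν : (K : ℕ) → Measure (Y K)) (RB : (K : ℕ) → ℝ → Repr172R (𝒢' K) (I' K))
    (trunc : ℕ → Idx I' → Idx I) (K : ℕ) (ZB : ℝ → ℝ) (ρB : ℝ → Y (K + 1) → ℝ)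
    (hZ : ∀ t, ZB t = ∫ y, ρB t y ∂(ν (K + 1)))
    (hH : ∀ t V, ρB t V = ∑ a : (I' (K + 1)).Adm, (RB (K + 1) t).term a V)
    (hint : ∀ t a, ∀ ι ∈ (I' (K + 1)).LIdx a, Integrable ((RB (K + 1) t).eterm a ι) (ν (K + 1)))
    (htr : ∀ τ' ∈ termSet I' (K + 1), trunc K τ' ∈ termSet I K) (t : ℝ) :
    ZB t = ∑ τ ∈ termSet I K, weightB ν RB trunc K t τ := by
  rw [repr_of_holds ν RB (K + 1) ZB ρB hZ hH hint t, weightB]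
  exact (sum_aggW_eq (S := fun K => termSet I' (K + 1)) (w := fun _ t τ' => weight ν RB t τ') htr).symm

/-- **THE END's PAIR OVER ONE TERM SET** (R-OWNER-46-2): run A by `repr_of_holds` at cutoff `K` over its own skeleton
`I`, run B by `reprB_of_holds_trunc` — `reprA`∕`reprB` of `CountRoadWitnessT3bWTVS` with `T := termSet I`,
`A := fun K t => weight μ RA t`, `A' := weightB ν RB trunc`. [folklore] -/
theorem repr_pair_of_holds_trunc (μ : (K : ℕ) → Measure (X K)) (ν : (K : ℕ) → Measure (Y K))
    (RA : (K : ℕ) → ℝ → Repr172R (𝒢 K) (I K)) (RB : (K : ℕ) → ℝ → Repr172R (𝒢' K) (I' K))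
    (trunc : ℕ → Idx I' → Idx I) (K : ℕ) (ZA ZB : ℝ → ℝ) (ρA : ℝ → X K → ℝ) (ρB : ℝ → Y (K + 1) → ℝ)
    (hZA : ∀ t, ZA t = ∫ x, ρA t x ∂(μ K)) (hZB : ∀ t, ZB t = ∫ y, ρB t y ∂(ν (K + 1)))
    (hHA : ∀ t V, ρA t V = ∑ a : (I K).Adm, (RA K t).term a V)
    (hHB : ∀ t V, ρB t V = ∑ a : (I' (K + 1)).Adm, (RB (K + 1) t).term a V)
    (hintA : ∀ t a, ∀ ι ∈ (I K).LIdx a, Integrable ((RA K t).eterm a ι) (μ K))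
    (hintB : ∀ t a, ∀ ι ∈ (I' (K + 1)).LIdx a, Integrable ((RB (K + 1) t).eterm a ι) (ν (K + 1)))
    (htr : ∀ τ' ∈ termSet I' (K + 1), trunc K τ' ∈ termSet I K) (t : ℝ) :
    ZA t = ∑ τ ∈ termSet I K, weight μ RA t τ ∧ ZB t = ∑ τ ∈ termSet I K, weightB ν RB trunc K t τ :=
  ⟨repr_of_holds μ RA K ZA ρA hZA hHA hintA t, reprB_of_holds_trunc ν RB trunc K ZB ρB hZB hHB hintB htr t⟩

/-- **U1 INTEGRATED PER AGGREGATE**: an aggregated weight is bounded by the aggregate of the absolute weights (each of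
which M2-A's `abs_weight_le` bounds by the history's factor product times the total mass). [folklore] -/
theorem abs_weightB_le (ν : (K : ℕ) → Measure (Y K)) (RB : (K : ℕ) → ℝ → Repr172R (𝒢' K) (I' K))
    (trunc : ℕ → Idx I' → Idx I) (K : ℕ) (t : ℝ) (τ : Idx I) :
    |weightB ν RB trunc K t τ| ≤ ∑ τ' ∈ (termSet I' (K + 1)).filter (fun τ' => trunc K τ' = τ), |weight ν RB t τ'| :=
  Finset.abs_sum_le_sum_abs _ _

/-- run-B aggregates of non-negative elementary terms are non-negative (`weight_nonneg` per term). [folklore] -/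
theorem weightB_nonneg (ν : (K : ℕ) → Measure (Y K)) (RB : (K : ℕ) → ℝ → Repr172R (𝒢' K) (I' K))
    (trunc : ℕ → Idx I' → Idx I) (K : ℕ) (t : ℝ) (hχ : ∀ K a V, 0 ≤ (RB K t).χ a V) (τ : Idx I) :
    0 ≤ weightB ν RB trunc K t τ :=
  aggW_nonneg fun τ' _ _ => weight_nonneg ν RB t hχ τ'

/-- every run-B term aggregated at cutoff `K` carries run B's level tag `K + 1` [folklore] -/
theorem fst_eq_of_mem_aggFibre (trunc : ℕ → Idx I' → Idx I) {K : ℕ} {τ : Idx I} {τ' : Idx I'}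
    (h : τ' ∈ (termSet I' (K + 1)).filter (fun τ' => trunc K τ' = τ)) : τ'.1 = K + 1 :=
  fst_eq_of_mem_termSet I' (mem_filter.1 h).1

end ReprB

/-! ## §4 Sanity (decided toy): three run-B terms over two run-A terms -/

section Toy

/-- toy truncation `Fin 3 → Fin 2`: terms `0, 1 ↦ 0`, `2 ↦ 1` [folklore] -/
def truncToy : ℕ → Fin 3 → Fin 2 := fun _ i => if i.val < 2 then 0 else 1

/-- toy run-B data: the term's index plus one [folklore] -/
def wToy : ℕ → ℝ → Fin 3 → ℝ := fun _ _ i => (i.val : ℝ) + 1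

/-- the toy aggregate over `0` collects the two terms `1 + 2` [folklore] -/
example : aggW truncToy (fun _ => Finset.univ) wToy 0 0 0 = 3 := by
  rw [aggW_def, show (Finset.univ : Finset (Fin 3)).filter (fun τ' => truncToy 0 τ' = 0) = {0, 1} by decide]
  simp [wToy]
  norm_num

/-- the toy aggregate over `1` collects the single term `3` [folklore] -/
example : aggW truncToy (fun _ => Finset.univ) wToy 0 0 1 = 3 := by
  rw [aggW_def, show (Finset.univ : Finset (Fin 3)).filter (fun τ' => truncToy 0 τ' = 1) = {2} by decide]
  simp [wToy]
  norm_num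

/-- the aggregation identity on the toy: `3 + 3 = 1 + 2 + 3` [folklore] -/
example : ∑ τ ∈ (Finset.univ : Finset (Fin 2)), aggW truncToy (fun _ => Finset.univ) wToy 0 0 τ =
    ∑ τ' ∈ (Finset.univ : Finset (Fin 3)), wToy 0 0 τ' :=
  sum_aggW_eq (T := fun _ => Finset.univ) fun _ _ => Finset.mem_univ _

end Toy

end

end Summit.QuantumFields.BalabanUV.T4Continuum.B16HistoryIndexedTrunc
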